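import Summits.AtomisticToContinuum.Crystallization.Theorems.FreeSplittingCertificatesStrictSplittingRuleP1CellMomentsExact
import Summits.AtomisticToContinuum.Crystallization.Theorems.FreeSplittingCertificatesStrictSplittingRuleP1Reproduce

/-!
# `StrictSplittingRule` (stmt-AtomisticToContinuum-12560): exact second moments and the FIRST MOMENT of a hat function on each REAL cell (P1 interpolant object, part 24)

Route `FreeSplittingCertificates`, crux r3 `StrictSplittingRule` (H12⋆ = `stub_coreJointCoercive`), unit b2b-freesplit-B gen 27.
VALUE = the cell-level form of part 23 on the hcp honeycomb (HOME FAR-LEMMA-SPEC §19 (d), CERT §28 (1)): for every real cell `T` of volume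
`|T| = √3·a²·h/12` and its hat functions `λ_m = p1Lam a h i m`,
* `setIntegral_p1Lam_mul`: **`∫_T λ_mλ_{m'} = |T|/10` (`m = m'`) resp. `|T|/20` (`m ≠ m'`)** (was `≤ |T|/16`, part 22);
* `setIntegral_p1Lam_mul_coord_sub`: **`∫_T λ_m(y)·(y_k − (y_m)_k) dy = (|T|/20)·Σ_{m'} ((y_{m'})_k − (y_m)_k)`** — the first moment of the hat
  function of vertex `m` over the cell is `|T|/20` times the sum of the three edge vectors from `y_m` (barycentric reproduction
  `Σ_{m'} λ_{m'} y_{m'} = y`, part `…P1Reproduce`).  Summed over the 24 cells of a vertex star this is the site's hat first moment `V_site·m₁`,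
  which is NOT zero for the quarter triangulation (CERT §28 (1)) — the constant of the per-site domination lemma beyond the near reach.
NOT a proof of H12⋆, NOT summit progress.  [folklore: P1 finite elements]
-/

noncomputable section

open Set Function Metric MeasureTheory Filter Topology
open scoped BigOperators NNReal ENNReal

namespace Summit.AtomisticToContinuum.Crystallization.Theorems.StrictSplittingRuleBirth

open Summit.AtomisticToContinuum.Crystallization.Theorems.PalmUnimodularRigidity.LayeredLawsSelectHcp (hcpSite)

/-- **Exact second moments of a real cell**: `∫_T λ_mλ_{m'} = √3a²h/120 = |T|/10` if `m = m'`, `√3a²h/240 = |T|/20` otherwise.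
NOT a proof of H12⋆, NOT summit progress. -/
theorem setIntegral_p1Lam_mul {a h : ℝ} (ha : 0 < a) (hh : 0 < h) (i : (ℤ × ℤ × ℤ) × Fin 6) (m m' : Fin 4) :
    ∫ y in p1RealCell a h i, p1Lam a h i m y * p1Lam a h i m' y =
      if m = m' then √3 * a ^ 2 * h / 120 else √3 * a ^ 2 * h / 240 := by
  have hg : Measurable fun q : Fin 3 → ℝ => p1Bary (p1Par i.1) i.2 m q * p1Bary (p1Par i.1) i.2 m' q := by
    have : Continuous fun q : Fin 3 → ℝ => p1Bary (p1Par i.1) i.2 m q * p1Bary (p1Par i.1) i.2 m' q := by unfold p1Bary; fun_prop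
    exact this.measurable
  have key := setIntegral_p1RealCell_transport ha hh i hg
  have haff : ∫ y in p1RealCell a h i, p1Lam a h i m y * p1Lam a h i m' y =
      ∫ y in p1RealCell a h i, (fun q => p1Bary (p1Par i.1) i.2 m q * p1Bary (p1Par i.1) i.2 m' q)
        ((p1ChartInvAff a h i.1.1 0 - p1Vec i.1) + p1ChartInvCLM a h i.1.1 y) := by
    refine setIntegral_congr_fun (isClosed_p1RealCell a h i).measurableSet fun y hy => ?_
    have hs := p1RealCell_slab hy
    simp only [p1Lam, p1ChartInv_eq_clm a h i.1.1 hs.1 hs.2]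
    congr 2 <;> abel
  rw [haff, key, setIntegral_p1Bary_mul_p1RefCell]
  split_ifs <;> ring

/-- Products `λ_m·λ_{m'}` are integrable on the cell. -/
theorem integrableOn_p1Lam_mul {a h : ℝ} (ha : 0 < a) (hh : 0 < h) (i : (ℤ × ℤ × ℤ) × Fin 6) (m m' : Fin 4) :
    IntegrableOn (fun y => p1Lam a h i m y * p1Lam a h i m' y) (p1RealCell a h i) volume :=
  ((continuous_p1Lam a h i m).mul (continuous_p1Lam a h i m')).continuousOn.integrableOn_compact
    (isCompact_p1RealCell ha.ne' hh.ne' i)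

/-- **First moment of a hat function over a real cell** (coordinate `k`, relative to its own vertex `y_m`):
`∫_T λ_m(y)·(y_k − (y_m)_k) dy = (√3a²h/240)·Σ_{m'} ((y_{m'})_k − (y_m)_k) = (|T|/20)·Σ_{m'≠m}(y_{m'} − y_m)_k`.
NOT a proof of H12⋆, NOT summit progress. -/
theorem setIntegral_p1Lam_mul_coord_sub {a h : ℝ} (ha : 0 < a) (hh : 0 < h) (i : (ℤ × ℤ × ℤ) × Fin 6) (m : Fin 4) (k : Fin 3) :
    ∫ y in p1RealCell a h i, p1Lam a h i m y * (y k - hcpSite a h (i.1 + p1VertOff (p1Par i.1) i.2 m) k) =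
      √3 * a ^ 2 * h / 240 * ∑ m' : Fin 4, (hcpSite a h (i.1 + p1VertOff (p1Par i.1) i.2 m') k - hcpSite a h (i.1 + p1VertOff (p1Par i.1) i.2 m) k) := by
  have hmeas : MeasurableSet (p1RealCell a h i) := (isClosed_p1RealCell a h i).measurableSet
  -- on the cell: y_k − (y_m)_k = Σ_{m'} λ_{m'}(y)·((y_{m'})_k − (y_m)_k)
  have hrep : ∀ y ∈ p1RealCell a h i, p1Lam a h i m y * (y k - hcpSite a h (i.1 + p1VertOff (p1Par i.1) i.2 m) k) =
      ∑ m' : Fin 4, (hcpSite a h (i.1 + p1VertOff (p1Par i.1) i.2 m') k - hcpSite a h (i.1 + p1VertOff (p1Par i.1) i.2 m) k) *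
        (p1Lam a h i m y * p1Lam a h i m' y) := by
    intro y hy
    have h1 := sum_p1Lam_eq_one a h i y
    have h2 := sum_p1Lam_mul_hcpSite ha.ne' hh.ne' hy k
    have e : y k - hcpSite a h (i.1 + p1VertOff (p1Par i.1) i.2 m) k =
        ∑ m' : Fin 4, p1Lam a h i m' y * (hcpSite a h (i.1 + p1VertOff (p1Par i.1) i.2 m') k - hcpSite a h (i.1 + p1VertOff (p1Par i.1) i.2 m) k) := by
      simp only [mul_sub, Finset.sum_sub_distrib, ← Finset.sum_mul, h1, h2, one_mul]
    rw [e, Finset.mul_sum]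
    refine Finset.sum_congr rfl fun m' _ => ?_
    ring
  rw [setIntegral_congr_fun hmeas hrep, integral_finsetSum _ (fun m' _ => (integrableOn_p1Lam_mul ha hh i m m').const_mul _)]
  simp only [integral_const_mul, setIntegral_p1Lam_mul ha hh, Finset.mul_sum]
  refine Finset.sum_congr rfl fun m' _ => ?_
  split_ifs with hmm
  · subst hmm; ring
  · ring

end Summit.AtomisticToContinuum.Crystallization.Theorems.StrictSplittingRuleBirth

end
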